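import Summits.QuantumFields.YangMills.Theorems.SwapVirialDeficitSectorLaplaceTipMidShellIntegrationIso
import Summits.QuantumFields.YangMills.Theorems.SwapVirialDeficitSectorLaplaceTipWindowReading
import HarnessLib

/-!
# THE TIP OF SKELETON ➎, CORE LAYER: the tip core `δ > d` against the shell from a per-hub, law-free ceiling (layer 2 of the tip plug)
# (cell ym-idea-1; free-hands support of ⟨stmt-QuantumFields-24197⟩ `SwapVirialDeficit.SwapGluedStiffness`; LEAD g99 ruling (R2) 2026-09-01 01:07Z «the core cut
# stays; (hCore) = a one-sided law-free Laplace ceiling, (1+δt²)-homogeneous»; producer w3 g68 `hubIntegral_hubAt_core_ceiling`; binder g49 01:10Z)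

Beyond the reach `δ ≤ δ_b(b)` of the two-sided law the hub integral `I(hubAt δt 1, ε; b)` is bounded ONE-SIDEDLY by the shell's Morse–Bott plane mass:
(hCore) `I(hubAt δt 1) ≤ Φ·(1+δt²)·P(δs) + T` for `δt > d`, `δs ∈ [a, c]`, `P(δs) = (2π/b)^α·∫_p 𝔪(hubAt δs 1, ε, p)` (or any shell profile `P ≥ 0`).
Averaging over the shell letter against `((1+δs²)⁻¹)²` (weight `W₂ = ∫_{[a,c]}((1+δ²)⁻¹)²`, ✓`integral_Icc_inv_one_add_sq_sq`) and integrating the core letter against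
`((1+δt²)⁻¹)² ≤ (1+δt²)⁻¹·(1+δt²)⁻¹` gives the `d⁻¹`-RATE (✓`setIntegral_inv_one_add_sq_le_inv`):
* ★★ `core_le_shell_of_pointwise` (abstract `I, P ≥ 0`): `∫_{Ioi d}((1+δ²)⁻¹)²·I ≤ (Φ/W₂)·d⁻¹·∫_{[a,c]}((1+δ²)⁻¹)²·P + T·d⁻¹`;
* ★★ `tipCore_le_shell_of_pointwise` — the hub integral against the shell plane mass in the letters of ✓`tipMid_window_le` ∕ ✓`shell_boxMass_le_mbMain`.
With `d = δ_b(b) → ∞` this is the `b^{−η}`-rate of ✓`core_of_two_rates`; the tail `T·d⁻¹ ≤ T` goes to ✓`tipTail_le`.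

HONEST LABEL: integration bookkeeping; (hCore), `stub_core_tip`, ⟨24197⟩ ∕ ⟨24194⟩ are OPEN; item of record ⟨24085⟩ `SubOctaveBounded` aside ∕ untouched; the Yang–Mills
mass gap is NOT proved; no summit is proved by a line.  THEOREMS ONLY (0 `def`, 0 `sorry`), standard axioms, no instances.  Seat ym-line-fcl-p3 g49 (cell ym-idea-1, free hands =
➎ assembler), `--supports stmt-QuantumFields-24197`.  References: [folklore]; [cite: Luscher1983, §2].
-/

set_option autoImplicit false
set_option synthInstance.maxSize 1024

noncomputable section

open MeasureTheory Quaternion Set Module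
open scoped Quaternion BigOperators ENNReal
open Literature.MathematicalPhysics.QuantumLattice
open Literature.MathematicalPhysics.QuantumFieldTheory hiding SU2
open Summit.QuantumFields.YangMills.Theorems.SwapTwistDeficit.ToronLog

namespace Summit.QuantumFields.YangMills.Theorems.SwapVirialDeficit.SectorLaplace

open Summit.QuantumFields.YangMills.Theorems.FemtoTransferGap
open Summit.QuantumFields.YangMills.Theorems.FemtoTransferGap.TT
open Summit.QuantumFields.YangMills.Theorems.VirialFluxGap.RingDeficit
open Summit.QuantumFields.YangMills.Theorems.SwapVirialDeficit.SwapRing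
open Summit.QuantumFields.YangMills.Theorems.SwapVirialDeficit.BlowUpRing

variable {L : ℕ} [NeZero L]

/-! ## §1 The abstract core layer -/

omit [NeZero L] in
/-- ★★ **CORE AGAINST SHELL FROM A PER-HUB CEILING, abstract.**  `I ≥ 0` on `Ioi d` (`d > 0`), `P ≥ 0` on `Icc a c` (`1 ≤ a < c`) with
`((1+δ²)⁻¹)²·P` integrable there, `Φ, T ≥ 0`, and (hCore) `I δt ≤ Φ·(1+δt²)·P δs + T` for `δt > d`, `δs ∈ Icc a c`.  Then
`∫_{Ioi d}((1+δ²)⁻¹)²·I ≤ Φ/W₂·d⁻¹·∫_{Icc a c}((1+δ²)⁻¹)²·P + T·d⁻¹`, `W₂ = (c/(1+c²) − a/(1+a²) + (arctan c − arctan a))/2`. [folklore] -/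
theorem core_le_shell_of_pointwise {I P : ℝ → ℝ} {d a c Φ T : ℝ} (hd : 0 < d) (ha : 1 ≤ a) (hac : a < c) (hΦ : 0 ≤ Φ) (hT : 0 ≤ T)
    (hI0 : ∀ δ ∈ Ioi d, 0 ≤ I δ) (hP0 : ∀ δ ∈ Icc a c, 0 ≤ P δ)
    (H : ∀ δt ∈ Ioi d, ∀ δs ∈ Icc a c, I δt ≤ Φ * (1 + δt ^ 2) * P δs + T)
    (hS : IntegrableOn (fun δ => ((1 + δ ^ 2)⁻¹) ^ 2 * P δ) (Icc a c)) :
    ∫ δ in Ioi d, ((1 + δ ^ 2)⁻¹) ^ 2 * I δ ≤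
      Φ / ((c / (1 + c ^ 2) - a / (1 + a ^ 2) + (Real.arctan c - Real.arctan a)) / 2) * d⁻¹ * (∫ δ in Icc a c, ((1 + δ ^ 2)⁻¹) ^ 2 * P δ) + T * d⁻¹ := by
  set W : ℝ := (c / (1 + c ^ 2) - a / (1 + a ^ 2) + (Real.arctan c - Real.arctan a)) / 2 with hW
  set B : ℝ := ∫ δ in Icc a c, ((1 + δ ^ 2)⁻¹) ^ 2 * P δ with hB
  have hWeq : ∫ x in Icc a c, ((1 + x ^ 2)⁻¹) ^ 2 = W := by rw [hW]; exact integral_Icc_inv_one_add_sq_sq hac.le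
  have hW0 : 0 < W := by
    rw [← hWeq]
    have hlow := integral_Icc_inv_one_add_sq_sq_ge ha hac.le
    have ha0 : 0 < a := by linarith
    have hc0 : 0 < c := by linarith
    have hlt : c⁻¹ ^ 3 < a⁻¹ ^ 3 := by
      have h1 : c⁻¹ < a⁻¹ := by rw [inv_lt_inv₀ hc0 ha0]; exact hac
      exact pow_lt_pow_left₀ h1 (by positivity) (by norm_num)
    linarith
  have hB0 : 0 ≤ B := by rw [hB]; exact setIntegral_nonneg measurableSet_Icc fun δ hδ => mul_nonneg (by positivity) (hP0 δ hδ)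
  -- step 1: average the ceiling over the shell letter
  have hstep : ∀ δt ∈ Ioi d, ((1 + δt ^ 2)⁻¹) ^ 2 * I δt * W ≤ Φ * (1 + δt ^ 2)⁻¹ * B + T * ((1 + δt ^ 2)⁻¹) ^ 2 * W := by
    intro δt hδt
    have hT1 : 0 < 1 + δt ^ 2 := by positivity
    have hpt : ∀ δs ∈ Icc a c, ((1 + δt ^ 2)⁻¹) ^ 2 * I δt * ((1 + δs ^ 2)⁻¹) ^ 2 ≤
        Φ * (1 + δt ^ 2)⁻¹ * (((1 + δs ^ 2)⁻¹) ^ 2 * P δs) + T * ((1 + δt ^ 2)⁻¹) ^ 2 * ((1 + δs ^ 2)⁻¹) ^ 2 := by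
      intro δs hδs
      have h := H δt hδt δs hδs
      have hw : 0 ≤ ((1 + δs ^ 2)⁻¹) ^ 2 := by positivity
      have hwt : 0 ≤ ((1 + δt ^ 2)⁻¹) ^ 2 := by positivity
      have h2 := mul_le_mul_of_nonneg_left (mul_le_mul_of_nonneg_left h hwt) hw
      have e : ((1 + δs ^ 2)⁻¹) ^ 2 * (((1 + δt ^ 2)⁻¹) ^ 2 * (Φ * (1 + δt ^ 2) * P δs + T)) =
          Φ * (1 + δt ^ 2)⁻¹ * (((1 + δs ^ 2)⁻¹) ^ 2 * P δs) + T * ((1 + δt ^ 2)⁻¹) ^ 2 * ((1 + δs ^ 2)⁻¹) ^ 2 := by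
        field_simp
      rw [e] at h2
      calc ((1 + δt ^ 2)⁻¹) ^ 2 * I δt * ((1 + δs ^ 2)⁻¹) ^ 2 = ((1 + δs ^ 2)⁻¹) ^ 2 * (((1 + δt ^ 2)⁻¹) ^ 2 * I δt) := by ring
        _ ≤ _ := h2
    have hinv : Continuous fun x : ℝ => (1 + x ^ 2)⁻¹ :=
      Continuous.inv₀ (f := fun x : ℝ => 1 + x ^ 2) (by fun_prop) (fun x => by show (1 + x ^ 2 : ℝ) ≠ 0; positivity)
    have hsq : IntegrableOn (fun δs : ℝ => ((1 + δs ^ 2)⁻¹) ^ 2) (Icc a c) := (hinv.pow 2).integrableOn_Icc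
    have hintL : IntegrableOn (fun δs : ℝ => ((1 + δt ^ 2)⁻¹) ^ 2 * I δt * ((1 + δs ^ 2)⁻¹) ^ 2) (Icc a c) := hsq.const_mul _
    have hintR : IntegrableOn (fun δs : ℝ => Φ * (1 + δt ^ 2)⁻¹ * (((1 + δs ^ 2)⁻¹) ^ 2 * P δs) + T * ((1 + δt ^ 2)⁻¹) ^ 2 * ((1 + δs ^ 2)⁻¹) ^ 2) (Icc a c) :=
      (hS.const_mul _).add (hsq.const_mul _)
    have hmono := setIntegral_mono_on hintL hintR measurableSet_Icc hpt
    rw [integral_const_mul, integral_add (hS.const_mul _) (hsq.const_mul _), integral_const_mul, integral_const_mul, hWeq, ← hB] at hmono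
    exact hmono
  -- step 2: divide by `W` and integrate the core letter
  have hpt2 : ∀ δt ∈ Ioi d, ((1 + δt ^ 2)⁻¹) ^ 2 * I δt ≤ (Φ * B / W + T) * (1 + δt ^ 2)⁻¹ := by
    intro δt hδt
    have h := (le_div_iff₀ hW0).2 (hstep δt hδt)
    have h1 : (1 + δt ^ 2)⁻¹ ≤ 1 := inv_le_one_of_one_le₀ (by nlinarith [sq_nonneg δt])
    have h1' : 0 ≤ (1 + δt ^ 2)⁻¹ := by positivity
    have hsq : ((1 + δt ^ 2)⁻¹) ^ 2 ≤ (1 + δt ^ 2)⁻¹ := by nlinarith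
    calc ((1 + δt ^ 2)⁻¹) ^ 2 * I δt ≤ (Φ * (1 + δt ^ 2)⁻¹ * B + T * ((1 + δt ^ 2)⁻¹) ^ 2 * W) / W := h
      _ = Φ * B / W * (1 + δt ^ 2)⁻¹ + T * ((1 + δt ^ 2)⁻¹) ^ 2 := by field_simp
      _ ≤ Φ * B / W * (1 + δt ^ 2)⁻¹ + T * (1 + δt ^ 2)⁻¹ := by nlinarith [mul_le_mul_of_nonneg_left hsq hT]
      _ = (Φ * B / W + T) * (1 + δt ^ 2)⁻¹ := by ring
  have hC0 : 0 ≤ Φ * B / W + T := by positivity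
  have hintg : IntegrableOn (fun δt : ℝ => (Φ * B / W + T) * (1 + δt ^ 2)⁻¹) (Ioi d) := (integrable_inv_one_add_sq.const_mul _).integrableOn
  have hmono2 : ∫ δ in Ioi d, ((1 + δ ^ 2)⁻¹) ^ 2 * I δ ≤ ∫ δ in Ioi d, (Φ * B / W + T) * (1 + δ ^ 2)⁻¹ := by
    refine integral_mono_of_nonneg ?_ hintg ?_
    · filter_upwards [ae_restrict_mem measurableSet_Ioi] with δ hδ using mul_nonneg (by positivity) (hI0 δ hδ)
    · filter_upwards [ae_restrict_mem measurableSet_Ioi] with δ hδ using hpt2 δ hδ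
  rw [integral_const_mul] at hmono2
  have htail := setIntegral_inv_one_add_sq_le_inv hd (subset_refl (Ioi d))
  calc ∫ δ in Ioi d, ((1 + δ ^ 2)⁻¹) ^ 2 * I δ ≤ (Φ * B / W + T) * ∫ δ in Ioi d, (1 + δ ^ 2)⁻¹ := hmono2
    _ ≤ (Φ * B / W + T) * d⁻¹ := mul_le_mul_of_nonneg_left htail hC0
    _ = Φ / W * d⁻¹ * B + T * d⁻¹ := by field_simp

/-! ## §2 The core layer for the hub integral against the shell plane mass -/

/-- ★★ **TIP CORE AGAINST SHELL FOR THE HUB INTEGRAL from the per-hub ceiling (hCore)** — the letters of ✓`tipMid_window_le` ∕ ✓`shell_boxMass_le_mbMain`: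
core `Ioi d` (`d > 0`), shell `Icc a c` (`1 ≤ a < c`), `Φ, T ≥ 0`, `b ≥ 0`; (hCore): `I(hubAt δt 1, ε; b) ≤ Φ·(1+δt²)·((2π/b)^α·∫_p 𝔪(hubAt δs 1, ε, p)) + T` for `δt > d`,
`δs ∈ Icc a c`; integrability of the shell integrand.  Then
`∫_{Ioi d}((1+δ²)⁻¹)²·I(hubAt δ 1) ≤ Φ/W₂·d⁻¹·(2π/b)^α·∫_{Icc a c}((1+δ²)⁻¹)²·∫_p𝔪(hubAt δ 1) + T·d⁻¹`. [cite: Luscher1983, §2] -/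
theorem tipCore_le_shell_of_pointwise (ε : GnoSign L) {d a c Φ T b : ℝ} (hd : 0 < d) (ha : 1 ≤ a) (hac : a < c) (hΦ : 0 ≤ Φ) (hT : 0 ≤ T) (hb : 0 ≤ b)
    (H : ∀ δt ∈ Ioi d, ∀ δs ∈ Icc a c,
      hubIntegral (L := L) (hubAt δt 1) ε b ≤ Φ * (1 + δt ^ 2) * ((2 * Real.pi / b) ^ alpha L * ∫ p : ℝ × ℝ, mbDensity (L := L) (hubAt δs 1) ε p) + T)
    (hS : IntegrableOn (fun δ : ℝ => ((1 + δ ^ 2)⁻¹) ^ 2 * ∫ p : ℝ × ℝ, mbDensity (L := L) (hubAt δ 1) ε p) (Icc a c)) :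
    ∫ δ in Ioi d, ((1 + δ ^ 2)⁻¹) ^ 2 * hubIntegral (L := L) (hubAt δ 1) ε b ≤
      Φ / ((c / (1 + c ^ 2) - a / (1 + a ^ 2) + (Real.arctan c - Real.arctan a)) / 2) * d⁻¹ *
          ((2 * Real.pi / b) ^ alpha L * ∫ δ in Icc a c, ((1 + δ ^ 2)⁻¹) ^ 2 * ∫ p : ℝ × ℝ, mbDensity (L := L) (hubAt δ 1) ε p) + T * d⁻¹ := by
  have hG0 : 0 ≤ (2 * Real.pi / b) ^ alpha L := Real.rpow_nonneg (div_nonneg (by positivity) hb) _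
  have hP0 : ∀ δ : ℝ, 0 ≤ (2 * Real.pi / b) ^ alpha L * ∫ p : ℝ × ℝ, mbDensity (L := L) (hubAt δ 1) ε p :=
    fun δ => mul_nonneg hG0 (integral_nonneg fun p => mbDensity_nonneg _ ε p)
  have hI0 : ∀ δ ∈ Ioi d, 0 ≤ hubIntegral (L := L) (hubAt δ 1) ε b := fun δ _ => (hubIntegral_hubAt_le_mass (L := L) hb δ ε).1
  have hS' : IntegrableOn (fun δ : ℝ => ((1 + δ ^ 2)⁻¹) ^ 2 * ((2 * Real.pi / b) ^ alpha L * ∫ p : ℝ × ℝ, mbDensity (L := L) (hubAt δ 1) ε p)) (Icc a c) := by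
    have e : (fun δ : ℝ => ((1 + δ ^ 2)⁻¹) ^ 2 * ((2 * Real.pi / b) ^ alpha L * ∫ p : ℝ × ℝ, mbDensity (L := L) (hubAt δ 1) ε p)) =
        fun δ : ℝ => (2 * Real.pi / b) ^ alpha L * (((1 + δ ^ 2)⁻¹) ^ 2 * ∫ p : ℝ × ℝ, mbDensity (L := L) (hubAt δ 1) ε p) := by
      funext δ; ring
    rw [e]; exact hS.const_mul _
  have h := core_le_shell_of_pointwise (I := fun δ => hubIntegral (L := L) (hubAt δ 1) ε b)
    (P := fun δ => (2 * Real.pi / b) ^ alpha L * ∫ p : ℝ × ℝ, mbDensity (L := L) (hubAt δ 1) ε p) hd ha hac hΦ hT hI0 (fun δ _ => hP0 δ) H hS'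
  have e2 : ∫ δ in Icc a c, ((1 + δ ^ 2)⁻¹) ^ 2 * ((2 * Real.pi / b) ^ alpha L * ∫ p : ℝ × ℝ, mbDensity (L := L) (hubAt δ 1) ε p) =
      (2 * Real.pi / b) ^ alpha L * ∫ δ in Icc a c, ((1 + δ ^ 2)⁻¹) ^ 2 * ∫ p : ℝ × ℝ, mbDensity (L := L) (hubAt δ 1) ε p := by
    rw [← integral_const_mul]
    refine integral_congr_ae (Filter.Eventually.of_forall fun δ => ?_)
    ring
  rw [e2] at h
  exact h

end Summit.QuantumFields.YangMills.Theorems.SwapVirialDeficit.SectorLaplace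

end
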